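import Mathlib
import Summits.AtomisticToContinuum.HydrodynamicLimit.Theorems.JaynesSqueezeHardSphereLDAInversion
import Literature.MathematicalPhysics.KineticTheory.MicroscaleWindowFunctionals
import HarnessLib

/-!
# RelayRaceLocality · ConeLocalisation — stub `stub_flatteningDensity`, part A: smooth inversion of the
# reduced activity map in one variable

Support file for the crux item `stmt-AtomisticToContinuum-12504` (`ConeLocalisation`, route RelayRaceLocality of
`AtomisticToContinuum/HydrodynamicLimit`), line `zoomed-bubble-transplant`, stub `stub_flatteningDensity`
(`FlatteningDensity`, `Theorems/RelayRaceLocalityConeLocalisationLocalDefs.lean`): the nonlinear flattening of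
the reduced density solves `Ψ(η₂) = A` pointwise, `Ψ = hsActivity` the reduced activity map, so it needs the
INVERSE of `Ψ` on the low-density band together with its smoothness and derivative bounds. This file is the
one-variable calculus, stated for an abstract `Φ : ℝ → ℝ` smooth on an open set `V ∋ 0` with `Φ′(0) > 0`
(`flatDen_inverse_package`): a band `[-η_b, η_b] ⊆ V` on which `Φ` is strictly increasing with
`|Φ′|, |Φ″|, |Φ‴| ≤ D`, and a globally monotone `G : ℝ → ℝ`, smooth on an open set containing
`[Φ(-η_b), Φ(η_b)]`, inverse to `Φ` there, with `|G′|, |G″|, |G‴| ≤ D` and `D`-Lipschitz on that interval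
(order-isomorphism extension `HardSphereLDA.exists_extension` + the easy direction of the inverse function
theorem `OpenPartialHomeomorph.contDiffAt_symm_deriv` + compactness). The instantiation to the analytic version
`Φ_F(η) = η·exp(F η + η F′ η)` of `hsActivity` (`F` the analytic excess free energy of `HsEosLowDensity`) is
`flatDen_phiF_contDiffOn`, `flatDen_deriv_phiF_zero`, `flatDen_hsActivity_eq_phiF`.
-/

noncomputable section

namespace Summit.AtomisticToContinuum.HydrodynamicLimit.Theorems.ConeLocalisation

open scoped Topology ContDiff
open Filter Set
open Literature.MathematicalPhysics.KineticTheory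

/-! ### A window of positive derivative -/

/-- If `Φ` is smooth on an open `V ∋ 0` with `Φ′(0) > 0`, then `Φ′ > Φ′(0)/2` on a symmetric open window
around `0` inside `V`. [folklore] -/
theorem flatDen_deriv_window {Φ : ℝ → ℝ} {V : Set ℝ} (hV : IsOpen V) (h0 : (0 : ℝ) ∈ V)
    (hΦ : ContDiffOn ℝ ∞ Φ V) (hΦ' : 0 < deriv Φ 0) :
    ∃ δ : ℝ, 0 < δ ∧ Ioo (-δ) δ ⊆ V ∧ ∀ η ∈ Ioo (-δ) δ, deriv Φ 0 / 2 < deriv Φ η := by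
  have hc : ContinuousOn (deriv Φ) V := hΦ.continuousOn_deriv_of_isOpen hV (by simp)
  have hca : ContinuousAt (deriv Φ) 0 := hc.continuousAt (hV.mem_nhds h0)
  have h1 : ∀ᶠ η in 𝓝 (0 : ℝ), deriv Φ 0 / 2 < deriv Φ η :=
    hca.tendsto.eventually_const_lt (by linarith)
  have h2 : ∀ᶠ η in 𝓝 (0 : ℝ), η ∈ V := hV.mem_nhds h0
  obtain ⟨δ, hδ, hδp⟩ := Metric.eventually_nhds_iff.1 (h1.and h2)
  have hmem : ∀ η ∈ Ioo (-δ) δ, dist η 0 < δ := fun η hη => by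
    rw [Real.dist_eq, sub_zero, abs_lt]; exact hη
  exact ⟨δ, hδ, fun η hη => (hδp (hmem η hη)).2, fun η hη => (hδp (hmem η hη)).1⟩

/-! ### The inverse as the symmetric of an order isomorphism, and its smoothness -/

/-- A continuous strictly increasing `Φ` on `[-η₁, η₁]`, smooth with nonvanishing derivative on the open
band, has a globally monotone continuous inverse `G` (`G ∘ Φ = id` on the band, `Φ ∘ G = id` on its image)
which is smooth on `(Φ(-η₁), Φ(η₁))`. [folklore] -/
theorem flatDen_exists_inverse {Φ : ℝ → ℝ} {V : Set ℝ} {η₁ : ℝ} (hV : IsOpen V) (hη₁ : 0 < η₁)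
    (hsub : Icc (-η₁) η₁ ⊆ V) (hΦ : ContDiffOn ℝ ∞ Φ V) (hpos : ∀ η ∈ Ioo (-η₁) η₁, 0 < deriv Φ η) :
    ∃ G : ℝ → ℝ, Monotone G ∧ Continuous G ∧ StrictMonoOn Φ (Icc (-η₁) η₁) ∧
      (∀ η ∈ Icc (-η₁) η₁, G (Φ η) = η) ∧
      (∀ y ∈ Icc (Φ (-η₁)) (Φ η₁), Φ (G y) = y ∧ G y ∈ Icc (-η₁) η₁) ∧
      (∀ y ∈ Ioo (Φ (-η₁)) (Φ η₁), G y ∈ Ioo (-η₁) η₁) ∧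
      ContDiffOn ℝ ∞ G (Ioo (Φ (-η₁)) (Φ η₁)) := by
  have hcont : ContinuousOn Φ (Icc (-η₁) η₁) := hΦ.continuousOn.mono hsub
  have hmono : StrictMonoOn Φ (Icc (-η₁) η₁) :=
    strictMonoOn_of_deriv_pos (convex_Icc _ _) hcont fun x hx => hpos x (by rwa [interior_Icc] at hx)
  obtain ⟨e, -, hec, heq⟩ := HardSphereLDA.exists_extension (h := Φ) (by linarith) hcont hmono
  have hl : (-η₁) ∈ Icc (-η₁) η₁ := ⟨le_rfl, by linarith⟩
  have hr : η₁ ∈ Icc (-η₁) η₁ := ⟨by linarith, le_rfl⟩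
  have hGΦ : ∀ η ∈ Icc (-η₁) η₁, e.symm (Φ η) = η := fun η hη => by
    rw [← heq η hη]; exact e.symm_apply_apply η
  have hGmem : ∀ y ∈ Icc (Φ (-η₁)) (Φ η₁), e.symm y ∈ Icc (-η₁) η₁ := fun y hy =>
    ⟨by simpa [hGΦ _ hl] using e.symm.monotone hy.1, by simpa [hGΦ _ hr] using e.symm.monotone hy.2⟩
  have hGmem' : ∀ y ∈ Ioo (Φ (-η₁)) (Φ η₁), e.symm y ∈ Ioo (-η₁) η₁ := fun y hy =>
    ⟨by simpa [hGΦ _ hl] using e.symm.strictMono hy.1, by simpa [hGΦ _ hr] using e.symm.strictMono hy.2⟩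
  refine ⟨e.symm, e.symm.monotone, hec, hmono, hGΦ, fun y hy => ⟨?_, hGmem y hy⟩, hGmem', ?_⟩
  · rw [← heq _ (hGmem y hy)]; exact e.apply_symm_apply y
  · -- smoothness: the easy direction of the inverse function theorem, at every point of the open image
    intro y hy
    set a : ℝ := e.symm y with ha
    have haI : a ∈ Ioo (-η₁) η₁ := hGmem' y hy
    have haV : a ∈ V := hsub (Ioo_subset_Icc_self haI)
    have hev : (⇑e : ℝ → ℝ) =ᶠ[𝓝 a] Φ := by
      filter_upwards [isOpen_Ioo.mem_nhds haI] with s hs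
      exact heq s (Ioo_subset_Icc_self hs)
    have hcd : ContDiffAt ℝ ∞ Φ a := hΦ.contDiffAt (hV.mem_nhds haV)
    have hd : HasDerivAt Φ (deriv Φ a) a := (hcd.differentiableAt (by simp)).hasDerivAt
    set f : OpenPartialHomeomorph ℝ ℝ := e.toHomeomorph.toOpenPartialHomeomorph with hf
    have hfe : (⇑f : ℝ → ℝ) = ⇑e := by simp [hf]
    have hfs : (⇑f.symm : ℝ → ℝ) = ⇑e.symm := by ext z; simp [hf]
    have hfa : f.symm y = a := by rw [hfs]
    have h1 : HasDerivAt (⇑f) (deriv Φ a) (f.symm y) := by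
      rw [hfe, hfa]; exact hd.congr_of_eventuallyEq hev
    have h2 : ContDiffAt ℝ ∞ (⇑f) (f.symm y) := by
      rw [hfe, hfa]; exact hcd.congr_of_eventuallyEq hev
    have h3 : ContDiffAt ℝ ∞ (⇑f.symm) y :=
      f.contDiffAt_symm_deriv (hpos a haI).ne' (by simp [hf]) h1 h2
    rw [hfs] at h3
    exact h3.contDiffWithinAt


/-! ### The package -/

/-- **Smooth local inversion package in one variable.** If `Φ` is smooth on an open `V ∋ 0` with
`Φ′(0) > 0`, there are a band `[-η_b, η_b] ⊆ V` on which `Φ` is strictly increasing with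
`|Φ′|, |Φ″|, |Φ‴| ≤ D`, and a globally monotone `G`, smooth on an open `W ⊇ [Φ(-η_b), Φ(η_b)]`, with
`G(Φ η) = η` on the band, `Φ(G y) = y` and `|G′|, |G″|, |G‴| ≤ D` on `[Φ(-η_b), Φ(η_b)]`, where `G` is
`D`-Lipschitz. [folklore] -/
theorem flatDen_inverse_package : ∀ {Φ : ℝ → ℝ} {V : Set ℝ}, IsOpen V → (0 : ℝ) ∈ V →
    ContDiffOn ℝ ∞ Φ V → 0 < deriv Φ 0 →
    ∃ ηb : ℝ, 0 < ηb ∧ Icc (-ηb) ηb ⊆ V ∧ StrictMonoOn Φ (Icc (-ηb) ηb) ∧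
    ∃ D : ℝ, 1 ≤ D ∧
      (∀ η ∈ Icc (-ηb) ηb, |deriv Φ η| ≤ D ∧ |deriv (deriv Φ) η| ≤ D ∧
        |deriv (deriv (deriv Φ)) η| ≤ D) ∧
    ∃ (G : ℝ → ℝ) (W : Set ℝ), IsOpen W ∧ ContDiffOn ℝ ∞ G W ∧ Icc (Φ (-ηb)) (Φ ηb) ⊆ W ∧
      Monotone G ∧ (∀ η ∈ Icc (-ηb) ηb, G (Φ η) = η) ∧
      (∀ y ∈ Icc (Φ (-ηb)) (Φ ηb), Φ (G y) = y ∧ G y ∈ Icc (-ηb) ηb) ∧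
      (∀ y ∈ Icc (Φ (-ηb)) (Φ ηb), |deriv G y| ≤ D ∧ |deriv (deriv G) y| ≤ D ∧
        |deriv (deriv (deriv G)) y| ≤ D) ∧
      (∀ y ∈ Icc (Φ (-ηb)) (Φ ηb), ∀ y' ∈ Icc (Φ (-ηb)) (Φ ηb), |G y - G y'| ≤ D * |y - y'|) := by
  intro Φ V hV h0 hΦ hΦ'
  obtain ⟨δ, hδ, hδV, hδp⟩ := flatDen_deriv_window hV h0 hΦ hΦ'
  -- the construction band `[-η₁, η₁]`, `η₁ = δ/2`, and the stated band `η_b = η₁/2`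
  set η₁ : ℝ := δ / 2 with hη₁
  have hη₁0 : 0 < η₁ := by positivity
  have hsub₁ : Icc (-η₁) η₁ ⊆ V := fun η hη => hδV ⟨by rw [hη₁] at hη; linarith [hη.1], by
    rw [hη₁] at hη; linarith [hη.2]⟩
  have hpos : ∀ η ∈ Ioo (-η₁) η₁, 0 < deriv Φ η := fun η hη =>
    (half_pos hΦ').trans (hδp η ⟨by rw [hη₁] at hη; linarith [hη.1], by rw [hη₁] at hη; linarith [hη.2]⟩)
  obtain ⟨G, hGm, -, hmono, hGΦ, hΦG, hGI, hGcd⟩ := flatDen_exists_inverse hV hη₁0 hsub₁ hΦ hpos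
  set ηb : ℝ := η₁ / 2 with hηb
  have hηb0 : 0 < ηb := by positivity
  have hbsub : Icc (-ηb) ηb ⊆ Icc (-η₁) η₁ := Icc_subset_Icc (by rw [hηb]; linarith) (by rw [hηb]; linarith)
  have hbl : (-ηb) ∈ Icc (-η₁) η₁ := hbsub ⟨le_rfl, by linarith⟩
  have hbr : ηb ∈ Icc (-η₁) η₁ := hbsub ⟨by linarith, le_rfl⟩
  have hl₁ : (-η₁) ∈ Icc (-η₁) η₁ := ⟨le_rfl, by linarith⟩
  have hr₁ : η₁ ∈ Icc (-η₁) η₁ := ⟨by linarith, le_rfl⟩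
  -- the image interval of the stated band sits inside the open image of the construction band
  set W : Set ℝ := Ioo (Φ (-η₁)) (Φ η₁) with hW
  have hKW : Icc (Φ (-ηb)) (Φ ηb) ⊆ W := fun y hy =>
    ⟨(hmono hl₁ hbl (by rw [hηb]; linarith)).trans_le hy.1, hy.2.trans_lt (hmono hbr hr₁ (by rw [hηb]; linarith))⟩
  have hKsub : Icc (Φ (-ηb)) (Φ ηb) ⊆ Icc (Φ (-η₁)) (Φ η₁) := fun y hy => Ioo_subset_Icc_self (hKW hy)
  -- bounds by compactness
  have hΦ1 : ContDiffOn ℝ ∞ (deriv Φ) V := hΦ.deriv_of_isOpen hV (by simp)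
  have hΦ2 : ContDiffOn ℝ ∞ (deriv (deriv Φ)) V := hΦ1.deriv_of_isOpen hV (by simp)
  have hΦ3 : ContDiffOn ℝ ∞ (deriv (deriv (deriv Φ))) V := hΦ2.deriv_of_isOpen hV (by simp)
  have hWo : IsOpen W := isOpen_Ioo
  have hG1 : ContDiffOn ℝ ∞ (deriv G) W := hGcd.deriv_of_isOpen hWo (by simp)
  have hG2 : ContDiffOn ℝ ∞ (deriv (deriv G)) W := hG1.deriv_of_isOpen hWo (by simp)
  have hG3 : ContDiffOn ℝ ∞ (deriv (deriv (deriv G))) W := hG2.deriv_of_isOpen hWo (by simp)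
  have hbV : Icc (-ηb) ηb ⊆ V := hbsub.trans hsub₁
  obtain ⟨C₁, hC₁⟩ := isCompact_Icc.exists_bound_of_continuousOn (hΦ1.continuousOn.mono hbV)
  obtain ⟨C₂, hC₂⟩ := isCompact_Icc.exists_bound_of_continuousOn (hΦ2.continuousOn.mono hbV)
  obtain ⟨C₃, hC₃⟩ := isCompact_Icc.exists_bound_of_continuousOn (hΦ3.continuousOn.mono hbV)
  obtain ⟨C₄, hC₄⟩ := isCompact_Icc.exists_bound_of_continuousOn (hG1.continuousOn.mono hKW)
  obtain ⟨C₅, hC₅⟩ := isCompact_Icc.exists_bound_of_continuousOn (hG2.continuousOn.mono hKW)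
  obtain ⟨C₆, hC₆⟩ := isCompact_Icc.exists_bound_of_continuousOn (hG3.continuousOn.mono hKW)
  set D : ℝ := 1 + |C₁| + |C₂| + |C₃| + |C₄| + |C₅| + |C₆| with hD
  have a₁ := abs_nonneg C₁; have a₂ := abs_nonneg C₂; have a₃ := abs_nonneg C₃
  have a₄ := abs_nonneg C₄; have a₅ := abs_nonneg C₅; have a₆ := abs_nonneg C₆
  have hD1 : 1 ≤ D := by rw [hD]; linarith
  have bd : ∀ {t C : ℝ}, ‖t‖ ≤ C → |C| ≤ D → |t| ≤ D := fun h h' =>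
    ((Real.norm_eq_abs _).symm.le.trans h).trans ((le_abs_self _).trans h')
  have hGbd : ∀ y ∈ Icc (Φ (-ηb)) (Φ ηb), |deriv G y| ≤ D ∧ |deriv (deriv G) y| ≤ D ∧
      |deriv (deriv (deriv G)) y| ≤ D := fun y hy =>
    ⟨bd (hC₄ y hy) (by rw [hD]; linarith), bd (hC₅ y hy) (by rw [hD]; linarith),
      bd (hC₆ y hy) (by rw [hD]; linarith)⟩
  refine ⟨ηb, hηb0, hbV, hmono.mono hbsub, D, hD1, fun η hη => ⟨bd (hC₁ η hη) (by rw [hD]; linarith),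
    bd (hC₂ η hη) (by rw [hD]; linarith), bd (hC₃ η hη) (by rw [hD]; linarith)⟩, G, W, hWo, hGcd, hKW, hGm,
    fun η hη => hGΦ η (hbsub hη), fun y hy => ⟨(hΦG y (hKsub hy)).1, ?_⟩, hGbd, fun y hy y' hy' => ?_⟩
  · -- `G y ∈ [-η_b, η_b]` by monotonicity
    exact ⟨by simpa [hGΦ _ hbl] using hGm hy.1, by simpa [hGΦ _ hbr] using hGm hy.2⟩
  · -- Lipschitz bound from `|G′| ≤ D` on the convex interval
    have hdiff : ∀ z ∈ Icc (Φ (-ηb)) (Φ ηb), DifferentiableAt ℝ G z := fun z hz =>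
      (hGcd.contDiffAt (hWo.mem_nhds (hKW hz))).differentiableAt (by simp)
    have h := Convex.norm_image_sub_le_of_norm_deriv_le hdiff
      (fun z hz => by rw [Real.norm_eq_abs]; exact (hGbd z hz).1) (convex_Icc _ _) hy' hy
    rwa [Real.norm_eq_abs, Real.norm_eq_abs] at h

/-! ### The analytic version `Φ_F` of the reduced activity map -/

/-- `Φ_F(η) = η·exp(F η + η F′ η)` is smooth on the analyticity interval of `F`. [folklore] -/
theorem flatDen_phiF_contDiffOn {F : ℝ → ℝ} {η₀ : ℝ} (hF : AnalyticOnNhd ℝ F (Ioo (-η₀) η₀)) :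
    ContDiffOn ℝ ∞ (fun η => η * Real.exp (F η + η * deriv F η)) (Ioo (-η₀) η₀) := by
  have hFc : ContDiffOn ℝ ∞ F (Ioo (-η₀) η₀) := hF.contDiffOn isOpen_Ioo.uniqueDiffOn
  have hF1c : ContDiffOn ℝ ∞ (deriv F) (Ioo (-η₀) η₀) := hF.deriv.contDiffOn isOpen_Ioo.uniqueDiffOn
  exact contDiffOn_id.mul (Real.contDiff_exp.comp_contDiffOn (hFc.add (contDiffOn_id.mul hF1c)))

/-- `Φ_F′(0) = 1` when `F 0 = 0`. [folklore] -/
theorem flatDen_deriv_phiF_zero {F : ℝ → ℝ} {η₀ : ℝ} (hη₀ : 0 < η₀) (hF : AnalyticOnNhd ℝ F (Ioo (-η₀) η₀))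
    (hF0 : F 0 = 0) : deriv (fun η => η * Real.exp (F η + η * deriv F η)) 0 = 1 := by
  have h0 : (0 : ℝ) ∈ Ioo (-η₀) η₀ := ⟨by linarith, hη₀⟩
  have hFc : ContDiffOn ℝ ∞ F (Ioo (-η₀) η₀) := hF.contDiffOn isOpen_Ioo.uniqueDiffOn
  have hF1c : ContDiffOn ℝ ∞ (deriv F) (Ioo (-η₀) η₀) := hF.deriv.contDiffOn isOpen_Ioo.uniqueDiffOn
  have hE : ContDiffOn ℝ ∞ (fun η => Real.exp (F η + η * deriv F η)) (Ioo (-η₀) η₀) :=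
    Real.contDiff_exp.comp_contDiffOn (hFc.add (contDiffOn_id.mul hF1c))
  have hEd : DifferentiableAt ℝ (fun η => Real.exp (F η + η * deriv F η)) 0 :=
    (hE.contDiffAt (isOpen_Ioo.mem_nhds h0)).differentiableAt (by simp)
  have h : HasDerivAt (fun η => η * Real.exp (F η + η * deriv F η))
      (1 * Real.exp (F 0 + 0 * deriv F 0) + 0 * deriv (fun η => Real.exp (F η + η * deriv F η)) 0) 0 :=
    (hasDerivAt_id' (0 : ℝ)).mul hEd.hasDerivAt
  rw [h.deriv]
  simp [hF0]

/-- On `[0, η₀)` the reduced activity map `hsActivity` IS `Φ_F` (`f_ex = F` there, and `f_ex′ = F′` on the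
open part; both vanish at `0`). [folklore] -/
theorem flatDen_hsActivity_eq_phiF {F : ℝ → ℝ} {η₀ : ℝ} (hEq : EqOn hsExcessFreeEnergy F (Ico 0 η₀)) :
    ∀ η ∈ Ico 0 η₀, hsActivity η = η * Real.exp (F η + η * deriv F η) := by
  intro η hη
  rcases hη.1.eq_or_lt with h | h
  · subst h; simp
  · unfold hsActivity
    rw [hEq hη, (HardSphereLDA.hsExcessFreeEnergy_eventuallyEq' hEq ⟨h, hη.2⟩).deriv_eq]

end Summit.AtomisticToContinuum.HydrodynamicLimit.Theorems.ConeLocalisation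

end
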